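import Summits.QuantumFields.GaugeBoot.Rows.SymB4
import HarnessLib

/-!
# Gauge-boot: symmetry kit `SymGram` — invariance of the raw Gram functionals and the SYMMETRY-FACTORISED block identity

Cell `pub-gaugeboot` (HOME `run/shared/lean/pub/pub-gaugeboot/`), seat lean1 (torus layer for the kz-L2-rp-4D family; reusable for
every `D = 4` family).  HONEST FRAMING (page 1 of every file of this cell): certified bounds on lattice expectations at STATED coupling,
gauge group, dimension and torus size; NOT a mass gap, NOT a continuum limit, NOT a string tension, NOT large `N`.
The venture is explicitly NOT Yang–Mills-summit-bearing (barriers `FixedCouplingUltralocality`, `PerturbativeInvisibility`).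

eng2's reduced positivity blocks (`code/gaugeboot/pos/gaugeboot/blocks.py`, `build_blocks`) have columns
`Y_j = (1/s_j)·Σ_{u∈𝔊} c(u)·e_{u·p_j}` with `c = den·e_k ∈ ℤ[𝔊]` a (scaled) symmetric primitive idempotent of the raw block's symmetry
group `𝔊 ⊂ B₄ × ℤ/2` and `p_j` ONE representative line per column.  For a symmetric, `𝔊`-invariant Gram functional `G` on closed words,
positive on admissible families (hypotheses `GSymm`/`GInv`/`GPsd`), the matrix
  `B_ij = (den/(s_i s_j)) · Σ_{t} c(t)·G(x_i, t·x_j)`   (sum over a list `tc` of codes carrying the support of `c`)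
equals `(1/(s_i s_j))·Σ_{t,t'} c(t)c(t')·G(t·x_i, t'·x_j)` by invariance, the group laws of `SymB4` and the convolution identity
`Σ_t c(t)·c(t·w) = den·c(w)` — a Gram form, hence positive semidefinite: `symBlock_posSemidef`.  This replaces the `nnz_i·nnz_j`-term
double expansion of `Y_kᵀ·cls·Y_k` by single sums (`KZL2rpD4`: 79.8M → ≈ 2M kernel terms).  First part: the raw functionals of the
three positivity families (`H`: `x⁻¹z`; site: `(θ'x)⁻¹z`; link: `(θ'x)⁻¹·(+e₀)·z·(−e₀)`) on words, their symmetry and their invariance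
under the table action `gactT` (link/site: for codes fixing the time axis).  Elementary [folklore].
-/

noncomputable section

open Literature.MathematicalPhysics.QuantumFieldTheory
open Finset Matrix

namespace Summit.QuantumFields.GaugeBoot

namespace SymB4

/-! ## The three raw functionals on words -/

/-- Raw `H` word `x⁻¹·z`. -/
def rawHw (x z : Word 4) : Word 4 := Word.reverse x ++ z

/-- Raw site-reflection word `(θ'x)⁻¹·z`. -/
def rawSw (x z : Word 4) : Word 4 := Word.reverse (x.map Step.reflect0) ++ z

/-- Raw link-reflection word `(θ'x)⁻¹·(+e₀)·z·(−e₀)`. -/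
def rawLw (x z : Word 4) : Word 4 := Word.reverse (x.map Step.reflect0) ++ [.fwd 0] ++ z ++ [.bwd 0]

/-- A code fixes the time axis (then it commutes with `θ'`). -/
abbrev Fix0 (u : ℕ) : Prop := smapT u (.fwd 0) = .fwd 0

/-- Relabelling by `smapT u` is lean2's move list, hence preserves `⟨W_0⟩` (any word). -/
theorem map_smapT_eq_acts (u : Fin 768) (w : Word 4) : w.map (smapT u.val) = Word.acts (b4 (u.val % 384)) w := by
  rw [acts_eq_map]
  refine List.map_congr_left fun st _ => ?_
  cases st with
  | fwd μ => exact (smapT_eq_actsStep u μ).1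
  | bwd μ => exact (smapT_eq_actsStep u μ).2

section W
variable (β : ℝ) (L : ℕ) [NeZero L]

/-- `⟨W_0(w relabelled)⟩ = ⟨W_0(w)⟩`. -/
theorem W_map_smapT (u : Fin 768) (w : Word 4) : Rung0D4.W β L (w.map (smapT u.val)) = Rung0D4.W β L w := by
  rw [map_smapT_eq_acts]
  exact wilsonExpectation_wordLoop_acts (suRep 2) (continuous_suRep 2) _ _ w

/-- Closedness of a relabelled word. -/
theorem disp_map_smapT (u : Fin 768) {w : Word 4} (hw : Word.disp w = 0) : Word.disp (w.map (smapT u.val)) = 0 := by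
  rw [map_smapT_eq_acts]; exact Word.disp_acts _ hw

/-- Core step of the reversal case: `⟨W_0(x'·z'⁻¹)⟩ = ⟨W_0(x'⁻¹·z')⟩`-type identity: for closed `P, Q`,
`⟨W_0(Q⁻¹⁻¹ ++ P⁻¹)⟩ = ⟨W_0(P)⟩` whenever `Q⁻¹ ++ … ` — stated in the form used below: `⟨W_0(A)⟩ = ⟨W_0(T)⟩` when `A⁻¹` is a
rotation of `T` and both are closed. -/
theorem W_of_reverse_eq_rotate {A T : Word 4} (n : ℕ) (hA : Word.disp A = 0) (hT : Word.disp T = 0)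
    (h : Word.reverse A = T.rotate n) : Rung0D4.W β L A = Rung0D4.W β L T := by
  rw [← GLYZc1D4.W_wordReverse β L A hA, h, GLYZc1D4.W_rotate β L T hT]

/-- `(u ++ v)⁻¹ = v⁻¹ ++ u⁻¹` and `[s]⁻¹ = [s⁻¹]` helpers. -/
theorem reverse_singleton (st : Step 4) : Word.reverse [st] = [st.inv] := rfl

/-- **`H` invariance**: `⟨W_0((u·x)⁻¹(u·z))⟩ = ⟨W_0(x⁻¹z)⟩` for closed `x, z` and every code `u < 768`. -/
theorem W_rawHw_gactT (u : Fin 768) (x z : Word 4) (hx : Word.disp x = 0) (hz : Word.disp z = 0) :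
    Rung0D4.W β L (rawHw (gactT u.val x) (gactT u.val z)) = Rung0D4.W β L (rawHw x z) := by
  have h0 : rawHw (x.map (smapT u.val)) (z.map (smapT u.val)) = (rawHw x z).map (smapT u.val) := by
    simp [rawHw, map_smapT_reverse u]
  rcases (by have := cc_lt u.val; omega : cc u.val = 0 ∨ cc u.val = 1) with hc | hc
  · have hg : ∀ w : Word 4, gactT u.val w = w.map (smapT u.val) := fun w => by simp [gactT, hc]
    rw [hg, hg, h0, W_map_smapT]
  · have hg : ∀ w : Word 4, gactT u.val w = Word.reverse (w.map (smapT u.val)) := fun w => by simp [gactT, hc]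
    rw [hg, hg]
    set x' := x.map (smapT u.val)
    set z' := z.map (smapT u.val)
    have hx' : Word.disp x' = 0 := disp_map_smapT u hx
    have hz' : Word.disp z' = 0 := disp_map_smapT u hz
    have hT : Word.disp (rawHw x' z') = 0 := by simp [rawHw, hx', hz']
    have hA : Word.disp (rawHw (Word.reverse x') (Word.reverse z')) = 0 := by simp [rawHw, hx', hz']
    rw [W_of_reverse_eq_rotate β L (Word.reverse x').length hA hT, h0, W_map_smapT]
    simp only [rawHw, reverse_reverse, Word.reverse_append]
    exact (List.rotate_append_length_eq _ _).symm

/-- `smapT u` commutes with `θ'` when it fixes the time axis. -/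
theorem smapT_reflect0 (u : Fin 768) (h : Fix0 u.val) (st : Step 4) :
    smapT u.val (Step.reflect0 st) = Step.reflect0 (smapT u.val st) := by
  have hb : smapT u.val (.bwd 0) = .bwd 0 := by rw [smapT_bwd u 0]; unfold Fix0 at h; rw [h]; rfl
  have key : ∀ μ : Fin 4, smapT u.val (Step.reflect0 (.fwd μ)) = Step.reflect0 (smapT u.val (.fwd μ)) ∧
      smapT u.val (Step.reflect0 (.bwd μ)) = Step.reflect0 (smapT u.val (.bwd μ)) := by
    -- the four axes: axis 0 uses the hypothesis, the others reduce to `smapT u (±e_μ) ≠ ±e_0`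
    have hinj : ∀ μ : Fin 4, μ ≠ 0 → (smapT u.val (.fwd μ) ≠ .fwd 0 ∧ smapT u.val (.fwd μ) ≠ .bwd 0) := by
      intro μ hμ
      constructor
      · intro hEq
        have := congrArg (smapT (inv u.val)) hEq
        rw [(smapT_inv_smapT u μ).1, ← h, (smapT_inv_smapT u 0).1] at this
        exact hμ (Step.fwd.inj this)
      · intro hEq
        have := congrArg (smapT (inv u.val)) hEq
        rw [(smapT_inv_smapT u μ).1, ← hb, (smapT_inv_smapT u 0).2] at this
        cases this
    intro μ
    by_cases hμ : μ = 0
    · subst hμ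
      unfold Fix0 at h
      simp [Step.reflect0, h, hb]
    · have hf := hinj μ hμ
      have hfr : Step.reflect0 (Step.fwd μ : Step 4) = .fwd μ := by simp [Step.reflect0, hμ]
      have hbr : Step.reflect0 (Step.bwd μ : Step 4) = .bwd μ := by simp [Step.reflect0, hμ]
      rw [hfr, hbr, smapT_bwd u μ]
      -- `smapT u (+e_μ)` is a step off the time axis, so `θ'` fixes it and its inverse
      rcases hs : smapT u.val (.fwd μ) with ν | ν
      · have hν : ν ≠ 0 := by rintro rfl; exact hf.1 hs
        simp [Step.reflect0, Step.inv, hν]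
      · have hν : ν ≠ 0 := by rintro rfl; exact hf.2 hs
        simp [Step.reflect0, Step.inv, hν]
  cases st with
  | fwd μ => exact (key μ).1
  | bwd μ => exact (key μ).2

/-- Relabelling by a time-axis-fixing code commutes with `θ'` on words. -/
theorem map_smapT_map_reflect0 (u : Fin 768) (h : Fix0 u.val) (w : Word 4) :
    (w.map Step.reflect0).map (smapT u.val) = (w.map (smapT u.val)).map Step.reflect0 := by
  simp only [List.map_map]
  exact List.map_congr_left fun st _ => smapT_reflect0 u h st

/-- **Site invariance**: `⟨W_0((θ'(u·x))⁻¹(u·z))⟩ = ⟨W_0((θ'x)⁻¹z)⟩` for closed `x, z` and codes fixing the time axis. -/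
theorem W_rawSw_gactT (u : Fin 768) (h : Fix0 u.val) (x z : Word 4) (hx : Word.disp x = 0) (hz : Word.disp z = 0) :
    Rung0D4.W β L (rawSw (gactT u.val x) (gactT u.val z)) = Rung0D4.W β L (rawSw x z) := by
  have h0 : ∀ x z : Word 4, rawSw (x.map (smapT u.val)) (z.map (smapT u.val)) = (rawSw x z).map (smapT u.val) := fun x z => by
    simp [rawSw, map_smapT_reverse u, map_smapT_map_reflect0 u h]
  rcases (by have := cc_lt u.val; omega : cc u.val = 0 ∨ cc u.val = 1) with hc | hc
  · have hg : ∀ w : Word 4, gactT u.val w = w.map (smapT u.val) := fun w => by simp [gactT, hc]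
    rw [hg, hg, h0, W_map_smapT]
  · have hg : ∀ w : Word 4, gactT u.val w = Word.reverse (w.map (smapT u.val)) := fun w => by simp [gactT, hc]
    rw [hg, hg]
    set x' := x.map (smapT u.val)
    set z' := z.map (smapT u.val)
    have hx' : Word.disp x' = 0 := disp_map_smapT u hx
    have hz' : Word.disp z' = 0 := disp_map_smapT u hz
    have hT : Word.disp (rawSw x' z') = 0 := by
      simp [rawSw, hz', Word.disp_map_reflect0_eq_zero hx']
    have hA : Word.disp (rawSw (Word.reverse x') (Word.reverse z')) = 0 := by
      have : Word.disp ((Word.reverse x').map Step.reflect0) = 0 := Word.disp_map_reflect0_eq_zero (by simp [hx'])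
      simp [rawSw, hz', this]
    rw [W_of_reverse_eq_rotate β L (Word.reverse (x'.map Step.reflect0)).length hA hT, h0, W_map_smapT]
    simp only [rawSw, GLYZc1D4.map_reflect0_wordReverse, reverse_reverse, Word.reverse_append]
    exact (List.rotate_append_length_eq _ _).symm

/-- **Link invariance**: the same for `(θ'x)⁻¹·(+e₀)·z·(−e₀)`. -/
theorem W_rawLw_gactT (u : Fin 768) (h : Fix0 u.val) (x z : Word 4) (hx : Word.disp x = 0) (hz : Word.disp z = 0) :
    Rung0D4.W β L (rawLw (gactT u.val x) (gactT u.val z)) = Rung0D4.W β L (rawLw x z) := by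
  have hf : smapT u.val (.fwd 0) = .fwd 0 := h
  have hb : smapT u.val (.bwd 0) = .bwd 0 := by rw [smapT_bwd u 0, hf]; rfl
  have h0 : ∀ x z : Word 4, rawLw (x.map (smapT u.val)) (z.map (smapT u.val)) = (rawLw x z).map (smapT u.val) := fun x z => by
    simp [rawLw, map_smapT_reverse u, map_smapT_map_reflect0 u h, hf, hb]
  rcases (by have := cc_lt u.val; omega : cc u.val = 0 ∨ cc u.val = 1) with hc | hc
  · have hg : ∀ w : Word 4, gactT u.val w = w.map (smapT u.val) := fun w => by simp [gactT, hc]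
    rw [hg, hg, h0, W_map_smapT]
  · have hg : ∀ w : Word 4, gactT u.val w = Word.reverse (w.map (smapT u.val)) := fun w => by simp [gactT, hc]
    rw [hg, hg]
    set x' := x.map (smapT u.val)
    set z' := z.map (smapT u.val)
    have hx' : Word.disp x' = 0 := disp_map_smapT u hx
    have hz' : Word.disp z' = 0 := disp_map_smapT u hz
    have hd0 : Word.disp ([.fwd 0] ++ z' ++ [.bwd 0] : Word 4) = 0 := by
      simp [hz', Step.disp]
    have hT : Word.disp (rawLw x' z') = 0 := by
      have := Word.disp_map_reflect0_eq_zero hx'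
      simp [rawLw, hz', this, Step.disp]
    have hA : Word.disp (rawLw (Word.reverse x') (Word.reverse z')) = 0 := by
      have : Word.disp ((Word.reverse x').map Step.reflect0) = 0 := Word.disp_map_reflect0_eq_zero (by simp [hx'])
      simp [rawLw, hz', this, Step.disp]
    rw [W_of_reverse_eq_rotate β L (Word.reverse (x'.map Step.reflect0)).length hA hT, h0, W_map_smapT]
    simp only [rawLw, GLYZc1D4.map_reflect0_wordReverse, reverse_reverse, Word.reverse_append, reverse_singleton,
      Step.inv, List.append_assoc]
    rw [List.rotate_append_length_eq]
    simp [List.append_assoc]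

end W

/-! ## Gram families and the symmetry-factorised block -/

section Fintype

variable {G : Word 4 → Word 4 → ℝ} {ok : Word 4 → Prop}

/-- Positivity on `Fin n`-indexed admissible closed families gives positivity for families indexed by any finite type. -/
theorem psd_fintype
    (hpsd : ∀ (n : ℕ) (O : Fin n → Word 4), (∀ i, Word.disp (O i) = 0) → (∀ i, ok (O i)) →
      ∀ a : Fin n → ℝ, 0 ≤ ∑ i, ∑ j, a i * a j * G (O i) (O j))
    {ι : Type*} [Fintype ι] (O : ι → Word 4)
    (hO : ∀ i, Word.disp (O i) = 0) (hok : ∀ i, ok (O i)) (a : ι → ℝ) :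
    0 ≤ ∑ i, ∑ j, a i * a j * G (O i) (O j) := by
  classical
  set e := Fintype.equivFin ι
  have h := hpsd (Fintype.card ι) (O ∘ e.symm) (fun i => hO _) (fun i => hok _) (a ∘ e.symm)
  have h1 : ∑ i, ∑ j, a i * a j * G (O i) (O j) = ∑ i : Fin (Fintype.card ι), ∑ j, a (e.symm i) * a j * G (O (e.symm i)) (O j) :=
    (e.symm.sum_comp (fun i => ∑ j, a i * a j * G (O i) (O j))).symm
  rw [h1]
  refine le_of_le_of_eq h (Finset.sum_congr rfl fun i _ => ?_)
  exact e.symm.sum_comp (fun j => a (e.symm i) * a j * G (O (e.symm i)) (O j))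

end Fintype

section Block

variable {G : Word 4 → Word 4 → ℝ} {ok : Word 4 → Prop} {stab : ℕ → Prop}
variable {nT : ℕ} (tc : Fin nT → Fin 768) (c : ℕ → ℤ)

/-- `G` symmetric on closed words. -/
abbrev GSymm (G : Word 4 → Word 4 → ℝ) : Prop := ∀ x z, Word.disp x = 0 → Word.disp z = 0 → G x z = G z x

/-- `G` invariant under the codes satisfying `stab`. -/
abbrev GInv (G : Word 4 → Word 4 → ℝ) (stab : ℕ → Prop) : Prop :=
  ∀ u : Fin 768, stab u.val → ∀ x z, Word.disp x = 0 → Word.disp z = 0 → G (gactT u.val x) (gactT u.val z) = G x z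

/-- `G` positive on closed `ok`-admissible families. -/
abbrev GPsd (G : Word 4 → Word 4 → ℝ) (ok : Word 4 → Prop) : Prop :=
  ∀ (n : ℕ) (O : Fin n → Word 4), (∀ i, Word.disp (O i) = 0) → (∀ i, ok (O i)) →
    ∀ a : Fin n → ℝ, 0 ≤ ∑ i, ∑ j, a i * a j * G (O i) (O j)

/-- A sum of `c`-weighted terms over the support list is the sum over all codes (terms vanish off the support). -/
theorem sum_tc_eq_sum_univ (htinj : Function.Injective tc) (hcT : ∀ u : Fin 768, c u.val ≠ 0 → ∃ t, tc t = u)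
    (f : ℕ → ℝ) : ∑ t, (c (tc t).val : ℝ) * f (tc t).val = ∑ v : Fin 768, (c v.val : ℝ) * f v.val := by
  classical
  have himg : ∑ t, (c (tc t).val : ℝ) * f (tc t).val = ∑ v ∈ (univ : Finset (Fin nT)).image tc, (c v.val : ℝ) * f v.val := by
    rw [Finset.sum_image fun t _ t' _ h => htinj h]
  rw [himg]
  refine Finset.sum_subset (Finset.subset_univ _) fun v _ hv => ?_
  have hc : c v.val = 0 := by
    by_contra hne
    obtain ⟨t, ht⟩ := hcT v hne
    exact hv (Finset.mem_image.mpr ⟨t, Finset.mem_univ _, ht⟩)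
  simp [hc]

/-- Left translation by a code is a bijection of the codes. -/
def mulEquiv (t : Fin 768) : Fin 768 ≃ Fin 768 where
  toFun w := ⟨mul t.val w.val, mul_lt _ _⟩
  invFun v := ⟨mul (inv t.val) v.val, mul_lt _ _⟩
  left_inv w := Fin.ext (mul_inv_cancel_left _ _ w.isLt)
  right_inv v := Fin.ext (mul_inv_cancel_right _ _ v.isLt)

/-- Reindexing a code sum by left translation. -/
theorem sum_reindex_mul (t : Fin 768) (g : ℕ → ℝ) :
    ∑ v : Fin 768, (c v.val : ℝ) * g (mul (inv t.val) v.val) = ∑ w : Fin 768, (c (mul t.val w.val) : ℝ) * g w.val := by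
  rw [← (mulEquiv t).sum_comp (fun v : Fin 768 => (c v.val : ℝ) * g (mul (inv t.val) v.val))]
  refine Finset.sum_congr rfl fun w _ => ?_
  simp only [mulEquiv, Equiv.coe_fn_mk, mul_inv_cancel_left _ _ w.isLt]

/-- **The double-sum identity**: for such a `G`, invariance + the group laws + the convolution identity give
`den · Σ_t c_t·G(x, t·z) = Σ_t Σ_t' c_t c_t'·G(t·x, t'·z)` (closed `x, z`). -/
theorem single_sum_eq_double_sum (hGi : GInv G stab) (hstabinv : ∀ u : Fin 768, stab u.val → stab (inv u.val))
    (htinj : Function.Injective tc) (hstab : ∀ t, stab (tc t).val) (hcT : ∀ u : Fin 768, c u.val ≠ 0 → ∃ t, tc t = u) (den : ℕ)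
    (hC1 : ∀ w : Fin 768, ∑ t, c (tc t).val * c (mul (tc t).val w.val) = den * c w.val)
    (x z : Word 4) (hx : Word.disp x = 0) (hz : Word.disp z = 0) :
    (den : ℝ) * ∑ t, (c (tc t).val : ℝ) * G x (gactT (tc t).val z) =
      ∑ t, ∑ t', (c (tc t).val : ℝ) * (c (tc t').val : ℝ) * G (gactT (tc t).val x) (gactT (tc t').val z) := by
  -- move `t·x` back to `x` inside each term
  have step1 : ∀ t t' : Fin nT, G (gactT (tc t).val x) (gactT (tc t').val z) = G x (gactT (mul (inv (tc t).val) (tc t').val) z) := by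
    intro t t'
    have hi : inv (tc t).val < 768 := inv_lt _
    have h := hGi ⟨inv (tc t).val, hi⟩ (hstabinv (tc t) (hstab t)) (gactT (tc t).val x) (gactT (tc t').val z)
      (disp_gactT (tc t) hx) (disp_gactT (tc t') hz)
    rw [← h]
    simp only
    rw [gactT_inv_gactT (tc t) x, ← gactT_mul ⟨inv (tc t).val, hi⟩ (tc t') z]
  simp_rw [step1]
  -- inner sums over the support become sums over all codes, then reindex by left translation
  have step2 : ∀ t : Fin nT, ∑ t', (c (tc t).val : ℝ) * (c (tc t').val : ℝ) * G x (gactT (mul (inv (tc t).val) (tc t').val) z) =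
      (c (tc t).val : ℝ) * ∑ w : Fin 768, (c (mul (tc t).val w.val) : ℝ) * G x (gactT w.val z) := by
    intro t
    rw [← sum_reindex_mul c (tc t) (fun w => G x (gactT w z)),
      ← sum_tc_eq_sum_univ tc c htinj hcT (fun v => G x (gactT (mul (inv (tc t).val) v) z)), Finset.mul_sum]
    refine Finset.sum_congr rfl fun t' _ => by ring
  simp_rw [step2]
  -- swap the sums and use the convolution identity
  have step3 : ∑ t, (c (tc t).val : ℝ) * ∑ w : Fin 768, (c (mul (tc t).val w.val) : ℝ) * G x (gactT w.val z) =
      ∑ w : Fin 768, (∑ t, (c (tc t).val : ℝ) * (c (mul (tc t).val w.val) : ℝ)) * G x (gactT w.val z) := by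
    simp_rw [Finset.mul_sum, Finset.sum_mul]
    rw [Finset.sum_comm]
    refine Finset.sum_congr rfl fun w _ => Finset.sum_congr rfl fun t _ => by ring
  rw [step3]
  have hC1' : ∀ w : Fin 768, ∑ t, (c (tc t).val : ℝ) * (c (mul (tc t).val w.val) : ℝ) = (den : ℝ) * c w.val := fun w => by
    exact_mod_cast hC1 w
  simp_rw [hC1']
  rw [sum_tc_eq_sum_univ tc c htinj hcT (fun w => G x (gactT w z)), Finset.mul_sum]
  exact Finset.sum_congr rfl fun w _ => by ring

/-- **The symmetry-factorised block is positive semidefinite.**  For such a `G`, a support list `tc` (injective codes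
satisfying `stab`), integer coefficients `c` vanishing off the list with `Σ_t c_t·c(t·w) = den·c(w)` (`den > 0`), closed
representative words `x_i` whose orbit words are admissible, and nonzero scalings `s_i`, the matrix
`B_ij = (den/(s_i s_j))·Σ_t c_t·G(x_i, t·x_j)` is positive semidefinite (it is the Gram matrix of `Σ_t (c_t/s_i)·(t·x_i)`). -/
theorem symBlock_posSemidef (hGs : GSymm G) (hGi : GInv G stab) (hstabinv : ∀ u : Fin 768, stab u.val → stab (inv u.val))
    (hGp : GPsd G ok) (htinj : Function.Injective tc) (hstab : ∀ t, stab (tc t).val) (hcT : ∀ u : Fin 768, c u.val ≠ 0 → ∃ t, tc t = u) (den : ℕ) (hden : 0 < den)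
    (hC1 : ∀ w : Fin 768, ∑ t, c (tc t).val * c (mul (tc t).val w.val) = den * c w.val)
    {m : ℕ} (x : Fin m → Word 4) (hx : ∀ i, Word.disp (x i) = 0) (hok : ∀ t i, ok (gactT (tc t).val (x i)))
    (s : Fin m → ℤ) (hs : ∀ i, s i ≠ 0) :
    (Matrix.of fun i j : Fin m => (den : ℝ) / (s i * s j) * ∑ t, (c (tc t).val : ℝ) * G (x i) (gactT (tc t).val (x j))).PosSemidef := by
  set D : Fin m → Fin m → ℝ := fun i j => ∑ t, ∑ t', (c (tc t).val : ℝ) * (c (tc t').val : ℝ) * G (gactT (tc t).val (x i)) (gactT (tc t').val (x j)) with hD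
  have hden' : (den : ℝ) ≠ 0 := by exact_mod_cast hden.ne'
  have hs' : ∀ i, (s i : ℝ) ≠ 0 := fun i => by exact_mod_cast hs i
  have hentry : ∀ i j : Fin m, (den : ℝ) / (s i * s j) * ∑ t, (c (tc t).val : ℝ) * G (x i) (gactT (tc t).val (x j)) = D i j / (s i * s j) := by
    intro i j
    rw [hD]; dsimp only
    rw [← single_sum_eq_double_sum tc c hGi hstabinv htinj hstab hcT den hC1 (x i) (x j) (hx i) (hx j)]
    field_simp
  have hDsymm : ∀ i j, D i j = D j i := by
    intro i j
    rw [hD]; dsimp only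
    rw [Finset.sum_comm]
    refine Finset.sum_congr rfl fun t' _ => Finset.sum_congr rfl fun t _ => ?_
    rw [hGs (gactT (tc t).val (x i)) (gactT (tc t').val (x j)) (disp_gactT (tc t) (hx i)) (disp_gactT (tc t') (hx j))]
    ring
  have hM : (Matrix.of fun i j : Fin m => (den : ℝ) / (s i * s j) * ∑ t, (c (tc t).val : ℝ) * G (x i) (gactT (tc t).val (x j))) =
      Matrix.of fun i j : Fin m => D i j / (s i * s j) := by
    ext i j; exact hentry i j
  rw [hM]
  refine Matrix.PosSemidef.of_dotProduct_mulVec_nonneg ?_ fun a => ?_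
  · ext i j
    simp only [Matrix.conjTranspose_apply, Matrix.of_apply, star_trivial, hDsymm i j, mul_comm (s i : ℝ) (s j)]
  · -- the quadratic form is the Gram form of the family `(i, t) ↦ t·x_i` with coefficients `a_i c_t / s_i`
    have quad : ∀ f : Fin m → Fin m → Fin nT → Fin nT → ℝ,
        ∑ i, ∑ j, ∑ t, ∑ t', f i j t t' = ∑ p : Fin m × Fin nT, ∑ q : Fin m × Fin nT, f p.1 q.1 p.2 q.2 := by
      intro f
      simp only [Fintype.sum_prod_type]
      exact Finset.sum_congr rfl fun i _ => Finset.sum_comm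
    have hq : star a ⬝ᵥ ((Matrix.of fun i j : Fin m => D i j / (s i * s j)) *ᵥ a) =
        ∑ i, ∑ j, ∑ t, ∑ t', (a i * c (tc t).val / s i) * (a j * c (tc t').val / s j) *
          G (gactT (tc t).val (x i)) (gactT (tc t').val (x j)) := by
      simp only [dotProduct, Matrix.mulVec, Matrix.of_apply, star_trivial, hD]
      refine Finset.sum_congr rfl fun i _ => ?_
      rw [Finset.mul_sum]
      refine Finset.sum_congr rfl fun j _ => ?_
      simp only [Finset.sum_div, Finset.sum_mul, Finset.mul_sum]
      refine Finset.sum_congr rfl fun t _ => Finset.sum_congr rfl fun t' _ => ?_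
      have hi := hs' i; have hj := hs' j
      field_simp
    rw [hq, quad]
    exact psd_fintype hGp (fun p : Fin m × Fin nT => gactT (tc p.2).val (x p.1)) (fun p => disp_gactT (tc p.2) (hx p.1))
      (fun p => hok p.2 p.1) (fun p => a p.1 * c (tc p.2).val / s p.1)

end Block

end SymB4

end Summit.QuantumFields.GaugeBoot

end
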